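import Mathlib
import Literature.AlgebraicGeometry.HodgeTheory.FermatShiodaCondition
import Literature.AlgebraicGeometry.Aoki1983.SemiStandard

/-!
# The level-33 torsion class `u₃₃`: failure of `(P₃₃)` and the parity obstruction (THEOREM H33, part A)

Solo-blind programme on `KontsevichZagierPeriods`, session 58 (companion file: `SoloBlindFermat33Lift66`,
the level-`66` certificate).  The programme's certificate (`paper/CERTIFICATE.md` §3f) records, for each
level `M`, the torsion of the quotient of the lattice of Hodge-type (Koblitz–Ogus) Gamma-monomials by the span
`D_M` of the three classical relation families (reflection pairs, Gauss multiplication characters = Aoki's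
standard elements, same-level two-term CM coincidences = Shioda's semi-decomposable sextuples).  At `M = 33`
this torsion is `ℤ/2`, generated by a class `a₃₃` (kernel: `SoloBlindFermatExceptional33`), which dies at
level `66` (`SoloBlindZ33Outright`).  Under the Shioda–Aoki dictionary (Hodge multisets `Mₘ` = effective
Hodge-type Gamma-monomials; `D`-generators = the classically KNOWN algebraic cycles on Fermat varieties) the
effective representative `u₃₃ = {2, 8, 11, 17, 29, 32} ⊂ ℤ/33 ∖ 0` of `a₃₃` is a Hodge character of the
Fermat fourfold `X⁴₃₃` — the degree for which "a simple computer verification shows that Shioda's program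
fails" (G. da Silva Jr., arXiv:2105.04695, p. 6; [daSilva2021HodgeFermat, §3]).  Kernel-checked here:

* `isHodgeMultiset_u33`: `u₃₃ ∈ M₃₃(3)`;
* `not_isDecomposable_u33`, `not_isQuasiDecomposable_u33`, `not_isSemiDecomposable_u33`, hence
  `not_shiodaCondition_thirtythree : ¬ (P₃₃)`.  The failure of the FOURFOLD condition `¬ (P⁴₃₃)` is ALREADY a
  kernel theorem of the tree, proved by the Hodge-conjecture programme with a different witness `(1,4,16,22,25,31)`:
  `Summit.HodgeConjecture.FermatCycles.ConditionQObstruction.not_shiodaConditionUpTo_thirtyThree_four_of_obstruction`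
  (file `Summits/HodgeConjecture/FermatCycles/ConditionQObstructionThirtyThreeC.lean`; not imported or restated here).
  The delta of this file is the SECOND witness `u₃₃` — the representative of the programme's torsion class `a₃₃`,
  which is the one needed by part B (`SoloBlindFermat33Lift66`: its pull-back to level `66` is Shioda-reachable) and by
  the parity theorem below — and the level-free corollary `¬ (P₃₃)` (method as in the tree's
  `FermatFourfoldFiveStandardSextuples`: norm equations at the units `1, 4, 5, 7, 10, 13, 14`, `33 · 2⁸` kernel cases);
* `odd_wcount_u33`, `even_wcount_of_mem_closure`, `u33_not_stably_standard`: `u₃₃` is not even STABLY in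
  the monoid generated by the pairs `{a, -a}` and the standard elements `σ_{3,i}`, `σ_{11,i}` (parity of
  the number of entries in `W = {11, 22}`).  Under the identification of these generators with generators of
  `S₃₃ + D₃₃` — [Aoki1983, §5 p. 36 (σ_{p,i}), Thm. D p. 38: `Sₘ` generated by the standard elements, `Dₘ` by
  `(1)+(−1)`], as transcribed in the tree's `Literature.AlgebraicGeometry.Aoki1983.SemiStandard` module docstring
  (Aoki's paper itself is not held as text by this programme, so the identification is quoted, not checked) —
  this says that `u₃₃` maps to the non-trivial part of `B₃₃/(S₃₃ + D₃₃)` (killed by `2`, Remark 5.4): its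
  Gamma-value identity is not a consequence of reflection + multiplication at level `33`.

Part B (`SoloBlindFermat33Lift66`) shows that the pull-back `(2)u₃₃` to level `66` IS accounted for by known
cycles (three semi-decomposable sextuples and six pairs), on Shioda's abstract families and on the tree's real
carriers modulo the named facts of Aoki 1987, Thm. 1-4.

## References

* [Shioda1979PJA] T. Shioda, Proc. Japan Acad. 55A (1979) 111–114, §1 Definitions (i)–(iii), (Pⁿₘ).
* [Shioda1979HodgeFermat] T. Shioda, Math. Ann. 245 (1979) 175–184, §4.
* [Aoki1983] N. Aoki, Math. Ann. 266 (1983) 23–54, §5 Thm. D, Remark 5.4 (p. 38), standard elements p. 36.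
* [Aoki1987] N. Aoki, J. Math. Soc. Japan 39 (1987) 385–396, §1 p. 387 (standard elements), Thm. 2-1.
* [daSilva2021HodgeFermat] G. da Silva Jr., arXiv:2101.04739, §2 Def. 2.4, §3 ((P₃₃) false, table of φ(m)).
* G. da Silva Jr., Known cases of the Hodge conjecture, arXiv:2105.04695, p. 6 (text read).
* Programme files: `SoloBlindFermatExceptional33` (parity, `v33`), `SoloBlindZ33Outright` (level-66 chain).
-/

open Literature.AlgebraicGeometry.HodgeTheory
open Literature.AlgebraicGeometry.HodgeTheory.FermatCharacter

namespace Summit.KontsevichZagierPeriods.KontsevichZagierPeriods.Theorems.SoloBlind.Fermat33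

/-! ### Level 33: the class `u₃₃` and the failure of `(P₃₃)` -/

/-- The effective representative `u₃₃ = {2, 8, 11, 17, 29, 32}` of the level-`33` torsion class `a₃₃`
(a Hodge character of `X⁴₃₃` up to permutation). [folklore] -/
def u33 : Multiset (ZMod 33) := {2, 8, 11, 17, 29, 32}

/-- `u₃₃ ∈ M₃₃(3)`: entries non-zero, sum `99 ≡ 0`, and `2 Σ⟨t a⟩ = 33 · 6` for all `20` units `t`.
[cite: Shioda1979PJA, §1 eq. (2)] -/
theorem isHodgeMultiset_u33 : IsHodgeMultiset u33 := by
  unfold u33 IsHodgeMultiset mNormSum; decide +kernel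

/-- Every proper non-empty sub-multiset of `u₃₃` has non-zero sum (no pair `{a,-a}`, no zero-sum triple).
[folklore] -/
theorem sum_ne_zero_of_mem_powerset_u33 :
    ∀ t ∈ Multiset.powerset u33, t ≠ 0 → u33 - t ≠ 0 → t.sum ≠ 0 := by
  unfold u33; decide +kernel

/-- `u₃₃` is **not decomposable**. [cite: Shioda1979PJA, §1 Definition (i)]
[cite: daSilva2021HodgeFermat, §2–3 ((P₃₃) fails)] -/
theorem not_isDecomposable_u33 : ¬ IsDecomposable u33 := by
  rintro ⟨t, u, ht0, hu0, ht, -, heq⟩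
  have htle : t ≤ u33 := heq ▸ Multiset.le_add_right t u
  have hu : u33 - t = u := by rw [heq, add_tsub_cancel_left]
  exact sum_ne_zero_of_mem_powerset_u33 t (Multiset.mem_powerset.2 htle) ht0 (hu ▸ hu0) ht.1.2

/-- `u₃₃` is **not semi-decomposable** (no zero-sum triple). [cite: Shioda1979PJA, §1 Definition (iii)] -/
theorem not_isSemiDecomposable_u33 : ¬ IsSemiDecomposable u33 := by
  rintro ⟨t, u, ht3, hu3, hts, -, heq⟩
  have htle : t ≤ u33 := heq ▸ Multiset.le_add_right t u
  have hu : u33 - t = u := by rw [heq, add_tsub_cancel_left]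
  have ht0 : t ≠ 0 := by rintro rfl; simp at ht3
  have hu0 : u ≠ 0 := by rintro rfl; simp at hu3
  exact sum_ne_zero_of_mem_powerset_u33 t (Multiset.mem_powerset.2 htle) ht0 (hu ▸ hu0) hts

/-- The finitely many necessary conditions (norm equations at the units `1, 4, 5, 7, 10, 13, 14` of `ℤ/33`)
used to refute quasi-decomposability, as a Boolean test. [cite: Shioda1979PJA, §1 eq. (2)] -/
def conds33 (v : Multiset (ZMod 33)) : Bool :=
  decide ((∀ a ∈ v, a ≠ 0) ∧ v.sum = 0 ∧
    2 * mNormSum (v.map fun a ↦ (1 : ZMod 33) * a) = 33 * Multiset.card v ∧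
    2 * mNormSum (v.map fun a ↦ (4 : ZMod 33) * a) = 33 * Multiset.card v ∧
    2 * mNormSum (v.map fun a ↦ (5 : ZMod 33) * a) = 33 * Multiset.card v ∧
    2 * mNormSum (v.map fun a ↦ (7 : ZMod 33) * a) = 33 * Multiset.card v ∧
    2 * mNormSum (v.map fun a ↦ (10 : ZMod 33) * a) = 33 * Multiset.card v ∧
    2 * mNormSum (v.map fun a ↦ (13 : ZMod 33) * a) = 33 * Multiset.card v ∧
    2 * mNormSum (v.map fun a ↦ (14 : ZMod 33) * a) = 33 * Multiset.card v)

/-- A Hodge multiset mod `33` passes the test `conds33`. [cite: Shioda1979PJA, §1 eq. (2)] -/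
theorem conds33_of_isHodgeMultiset {v : Multiset (ZMod 33)} (hv : IsHodgeMultiset v) : conds33 v = true := by
  have h1 := hv.2 (Units.mkOfMulEqOne 1 1 (by decide))
  have h4 := hv.2 (Units.mkOfMulEqOne 4 25 (by decide))
  have h5 := hv.2 (Units.mkOfMulEqOne 5 20 (by decide))
  have h7 := hv.2 (Units.mkOfMulEqOne 7 19 (by decide))
  have h10 := hv.2 (Units.mkOfMulEqOne 10 10 (by decide))
  have h13 := hv.2 (Units.mkOfMulEqOne 13 28 (by decide))
  have h14 := hv.2 (Units.mkOfMulEqOne 14 26 (by decide))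
  simp only [Units.val_mkOfMulEqOne] at h1 h4 h5 h7 h10 h13 h14
  exact decide_eq_true ⟨hv.1.1, hv.1.2, h1, h4, h5, h7, h10, h13, h14⟩

set_option maxHeartbeats 4000000 in
/-- The arithmetic heart of "`u₃₃` is not quasi-decomposable": for every `e ∈ ℤ/33` and every splitting
`u₃₃ + {e, -e} = t + u` into parts different from `u₃₃`, one of `t`, `u` fails the test `conds33`.
Kernel computation, one residue `e` at a time (`33 · 2⁸` cases). [cite: daSilva2021HodgeFermat, Def. 2.4] -/
theorem u33_key :
    ∀ e : ZMod 33, ∀ t ∈ Multiset.powerset (u33 + {e, -e}),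
      ¬ (t ≠ 0 ∧ u33 + {e, -e} - t ≠ 0 ∧ t ≠ u33 ∧ u33 + {e, -e} - t ≠ u33 ∧
          conds33 t = true ∧ conds33 (u33 + {e, -e} - t) = true) := by
  intro e
  obtain ⟨k, hk, rfl⟩ : ∃ k < 33, ((k : ℕ) : ZMod 33) = e := ⟨e.val, e.val_lt, ZMod.natCast_zmod_val e⟩
  unfold u33
  interval_cases k <;> decide +kernel

/-- `u₃₃` is **not quasi-decomposable**. [cite: daSilva2021HodgeFermat, Def. 2.4]
[cite: Shioda1979PJA, §1 Definition (ii)] -/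
theorem not_isQuasiDecomposable_u33 : ¬ IsQuasiDecomposable u33 := by
  rintro ⟨e, -, t, u, ht0, hu0, ht, hu, hts, hus, heq⟩
  have htle : t ≤ u33 + {e, -e} := heq ▸ Multiset.le_add_right t u
  have hu' : u33 + {e, -e} - t = u := by rw [heq, add_tsub_cancel_left]
  subst hu'
  exact u33_key e t (Multiset.mem_powerset.2 htle) ⟨ht0, hu0, hts, hus, conds33_of_isHodgeMultiset ht, conds33_of_isHodgeMultiset hu⟩

/-- **`(P₃₃)` fails** ("Shioda's program fails for `Xⁿ₃₃`"), witnessed by `u₃₃` at `n = 4`.  The fourfold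
statement `¬ ShiodaConditionUpTo 33 4` itself is the Hodge-conjecture programme's kernel theorem
`Summit.HodgeConjecture.FermatCycles.ConditionQObstruction.not_shiodaConditionUpTo_thirtyThree_four_of_obstruction`
(witness `(1,4,16,22,25,31)`); it is re-derived inline here from the second witness `u₃₃` and not restated as a
declaration. [cite: daSilva2021HodgeFermat, §3 ((P₃₃) false)] [cite: Shioda1979PJA, §1 condition (Pⁿₘ)] -/
theorem not_shiodaCondition_thirtythree : ¬ ShiodaCondition 33 := fun h ↦ by
  rcases shiodaCondition_iff_forall_upTo.1 h 4 _ isHodgeMultiset_u33 (by decide) (by decide) with hd | hq | hs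
  · exact not_isDecomposable_u33 hd
  · exact not_isQuasiDecomposable_u33 hq
  · exact not_isSemiDecomposable_u33 hs

/-! ### Level 33: `u₃₃` is not stably generated by pairs and standard elements (parity) -/

/-- The parity functional: the number of entries of `s` lying in `W = {11, 22} = (ℤ/33)[3] ∖ 0`. [folklore] -/
def wcount (s : Multiset (ZMod 33)) : ℕ := Multiset.card (s.filter fun x ↦ x = 11 ∨ x = 22)

/-- `wcount` is additive. [folklore] -/
theorem wcount_add (s t : Multiset (ZMod 33)) : wcount (s + t) = wcount s + wcount t := by
  simp [wcount, Multiset.filter_add]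

/-- Aoki's standard element `σ_{11,i} = (i, i+3, …, i+30, -11 i)` of level `33` (`p = 11`, `d = 3`), as a
multiset. [cite: Aoki1983, §5 p. 36 (σ_{p,i})] [cite: Aoki1987, §1 p. 387] -/
def sigmaEleven (i : ZMod 33) : Multiset (ZMod 33) :=
  (Multiset.range 11).map (fun k : ℕ ↦ i + (k : ZMod 33) * 3) + {-(11 * i)}

/-- The generating set used by the parity theorem: pairs `{a, -a}`, `σ_{3,i}`, `σ_{11,i}` (all `i`) — under the
identification quoted in the module docstring, generators of `S₃₃ + D₃₃` in effective form.
[cite: Aoki1983, §5 p. 36 (σ_{p,i}) and Thm. D p. 38, as transcribed in the tree's Aoki1983.SemiStandard] -/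
def SDGen33 : Set (Multiset (ZMod 33)) :=
  {s | (∃ a : ZMod 33, s = {a, -a}) ∨ (∃ i : ZMod 33, s = Literature.AlgebraicGeometry.Aoki1983.sigmaThree 33 i) ∨
    (∃ i : ZMod 33, s = sigmaEleven i)}

/-- Pairs have even `wcount` (`a ∈ W ↔ -a ∈ W`). [folklore] -/
theorem even_wcount_pair : ∀ a : ZMod 33, Even (wcount {a, -a}) := by
  unfold wcount; decide

/-- The standard elements `σ_{3,i}` have even `wcount`. [folklore] -/
theorem even_wcount_sigmaThree :
    ∀ i : ZMod 33, Even (wcount (Literature.AlgebraicGeometry.Aoki1983.sigmaThree 33 i)) := by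
  unfold wcount Literature.AlgebraicGeometry.Aoki1983.sigmaThree; decide

/-- The standard elements `σ_{11,i}` have even `wcount`. [folklore] -/
theorem even_wcount_sigmaEleven : ∀ i : ZMod 33, Even (wcount (sigmaEleven i)) := by
  unfold wcount sigmaEleven; decide

/-- Everything in the monoid generated by pairs and standard elements has even `wcount`. [folklore] -/
theorem even_wcount_of_mem_closure {s : Multiset (ZMod 33)} (h : s ∈ AddSubmonoid.closure SDGen33) :
    Even (wcount s) := by
  induction h using AddSubmonoid.closure_induction with
  | mem x hx =>
    rcases hx with ⟨a, rfl⟩ | ⟨i, rfl⟩ | ⟨i, rfl⟩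
    · exact even_wcount_pair a
    · exact even_wcount_sigmaThree i
    · exact even_wcount_sigmaEleven i
  | zero => exact ⟨0, rfl⟩
  | add x y _ _ hx hy => rw [wcount_add]; exact hx.add hy

/-- `wcount u₃₃ = 1` is odd. [folklore] -/
theorem odd_wcount_u33 : wcount u33 = 1 := by
  unfold wcount u33; decide

/-- **`u₃₃` is not stably generated by pairs and standard elements**: there are no `A`, `B` in the monoid
generated by `{a,-a}`, `σ_{3,i}`, `σ_{11,i}` with `u₃₃ + A = B` (the formal content).  Informally, under the
identification of these generators with those of `S₃₃ + D₃₃` quoted in the module docstring (not checked against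
Aoki's text here), `u₃₃` maps to the non-trivial part of `B₃₃/(S₃₃ + D₃₃)`. [cite: Aoki1983, Thm. D and Remark 5.4, p. 38] -/
theorem u33_not_stably_standard :
    ¬ ∃ A ∈ AddSubmonoid.closure SDGen33, ∃ B ∈ AddSubmonoid.closure SDGen33, u33 + A = B := by
  rintro ⟨A, hA, B, hB, h⟩
  have hw := congrArg wcount h
  rw [wcount_add, odd_wcount_u33] at hw
  obtain ⟨a, ha⟩ := even_wcount_of_mem_closure hA
  obtain ⟨b, hb⟩ := even_wcount_of_mem_closure hB
  omega

end Summit.KontsevichZagierPeriods.KontsevichZagierPeriods.Theorems.SoloBlind.Fermat33
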